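import Summits.CriticalPhenomena.PercolationContinuityZ3.Theorems.PercLowPointHalfSpaceLowPointBookkeepingStubFloorCouplingPivot
import Literature.Probability.Percolation.StarTriangleMoves

/-!
# Stub `stub_floorCoupling` of crux `LowPointBookkeeping` (stmt-CriticalPhenomena-14713), part 4: Fubini and assembly

File 4/4: the probability of the oriented pivotal event (resampled label, Fubini, factor `p_c/(1-p_c) ≤ 1`),
the union bound over floor pairs, and the registered stub `stub_floorCoupling` (line SketchIdeator1).
-/

noncomputable section

namespace Summit.CriticalPhenomena.PercolationContinuityZ3.Theorems.FloorRusso.Coupling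

open MeasureTheory Measure Set
open Literature.Probability.Percolation Literature.Probability.LatticeModels
open scoped ENNReal

/-! ### The probability of the oriented pivotal event: resampling the label and Fubini -/

section Fubini

variable {a b : Site 3}

/-- `s(x, x + e)` is a floor edge for `x` on the floor and `e` a floor unit vector. -/
theorem mk_mem_floorEdgeSet {x e : Site 3} (hx : x 0 = 0) (he : e ∈ nbrs) : s(x, x + e) ∈ Fl := by
  refine ⟨?_, fun z hz => ?_⟩
  · rw [SimpleGraph.mem_edgeSet, zdGraph_adj_iff]
    simp only [nbrs, Finset.mem_insert, Finset.mem_singleton] at he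
    rcases he with rfl | rfl | rfl | rfl
    · exact ⟨1, Or.inl rfl⟩
    · exact ⟨1, Or.inr (by rw [add_assoc, ← Pi.single_add]; simp)⟩
    · exact ⟨2, Or.inl rfl⟩
    · exact ⟨2, Or.inr (by rw [add_assoc, ← Pi.single_add]; simp)⟩
  · rcases Sym2.mem_iff.1 hz with rfl | rfl
    · exact hx
    · simp [hx, nbrs_floor e he]

/-- `ne_add_of_mem_nbrs` (helper, see the module docstring). -/
theorem ne_add_of_mem_nbrs (x : Site 3) {e : Site 3} (he : e ∈ nbrs) : x ≠ x + e := by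
  intro h
  have h0 : e = 0 := by simpa using h
  simp only [nbrs, Finset.mem_insert, Finset.mem_singleton] at he
  rcases he with rfl | rfl | rfl | rfl <;> simp_all [funext_iff, Fin.forall_fin_succ]

/-- If the pair `s(x, x')` is open, its endpoints are `ℍ`-joined (both in `ℍ`). -/
theorem conn_of_mem {ω : BondConfig (Site 3)} {x x' : Site 3} (hx : x ∈ HS) (hx' : x' ∈ HS)
    (hne : x ≠ x') (h : s(x, x') ∈ ω) : ω ∈ openConnIn HS x x' :=
  LowPoint.conn_step (LowPoint.conn_refl ω hx) h hne hx'

/-- **Closing the pivotal edge costs at most the factor `(1 - p_c)⁻¹`**: the pivotal-pair event is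
insensitive to the state of the pair itself except that it forces it closed, so its probability
under the weights with the pair zeroed is its `P^{ℍ}_{p_c,s}`-probability divided by `1 - s p_c`. -/
theorem prodBernoulli_update_zero_pivAt_le (s : unitInterval) {x e : Site 3} (hx : x 0 = 0) (he : e ∈ nbrs)
    (a b : Site 3) :
    prodBernoulli (Function.update (floorDilutedParam 3 pc s) s(x, x + e) 0) (pivAt x (x + e) a b) ≤
      ENNReal.ofReal ((1 - (pc : ℝ))⁻¹) * μH s (pivAt x (x + e) a b) := by
  classical
  set f : E3 := s(x, x + e) with hf
  set q : E3 → unitInterval := floorDilutedParam 3 pc s with hq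
  set E : Set (BondConfig (Site 3)) := pivAt x (x + e) a b with hE
  have hEm : MeasurableSet E := measurableSet_pivAt _ _ _ _
  have hxH : x ∈ HS := by simp [hx]
  have hx'H : x + e ∈ HS := by simp [hx, nbrs_floor e he]
  have hne : x ≠ x + e := ne_add_of_mem_nbrs x he
  have hEeq : E = ((fun ω : Set E3 => ω \ {f}) ⁻¹' E) ∩ {ω | f ∉ ω} := by
    ext ω
    simp only [mem_inter_iff, mem_preimage, mem_setOf_eq]
    constructor
    · intro hω
      have hfω : f ∉ ω := fun hfω => hω.2 (conn_of_mem hxH hx'H hne hfω)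
      rw [sdiff_singleton_eq_self hfω]
      exact ⟨hω, hfω⟩
    · rintro ⟨hω, hfω⟩
      rwa [sdiff_singleton_eq_self hfω] at hω
  have hA : DeterminedBy {ω : Set E3 | f ∉ ω} (↑({f} : Finset E3) : Set E3) := by
    rw [Finset.coe_singleton, determinedBy_iff]; intro ω ω' h
    simp only [mem_setOf_eq]
    have : f ∈ ω ↔ f ∈ ω' := by
      constructor
      · intro hf'; exact ((Set.ext_iff.1 h f).1 ⟨hf', Set.mem_singleton f⟩).1
      · intro hf'; exact ((Set.ext_iff.1 h f).2 ⟨hf', Set.mem_singleton f⟩).1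
    exact not_congr this
  have hB : DeterminedBy ((fun ω : Set E3 => ω \ {f}) ⁻¹' E) (↑({f} : Finset E3) : Set E3)ᶜ := by
    rw [Finset.coe_singleton, determinedBy_iff]; intro ω ω' h
    simp only [mem_preimage]
    have : ω \ {f} = ω' \ {f} := by
      rw [Set.sdiff_eq, Set.sdiff_eq]; exact h
    rw [this]
  have hBm : MeasurableSet ((fun ω : Set E3 => ω \ {f}) ⁻¹' E) :=
    (StarTriangle.measurable_sdiff_const {f}) hEm
  have hAm : MeasurableSet {ω : Set E3 | f ∉ ω} := (measurableSet_mem f).compl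
  have hind := prodBernoulli_real_inter_of_determinedBy q {f} hA hB hAm hBm
  have hmap : (prodBernoulli q).real ((fun ω : Set E3 => ω \ {f}) ⁻¹' E) =
      (prodBernoulli (Function.update q f 0)).real E := by
    rw [measureReal_def, measureReal_def, ← Measure.map_apply (StarTriangle.measurable_sdiff_const {f}) hEm,
      StarTriangle.prodBernoulli_map_sdiff_singleton]
  have hnot : (prodBernoulli q).real {ω : Set E3 | f ∉ ω} = 1 - (q f : ℝ) := prodBernoulli_real_setOf_notMem q f
  have hqf : (q f : ℝ) ≤ pc := by
    have := floorDilutedParam_le pc s f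
    exact_mod_cast this
  have hpc1 : (pc : ℝ) < 1 := by linarith [pc_lt_half]
  have hpos : 0 < 1 - (q f : ℝ) := by linarith
  have hprod : (prodBernoulli q).real E = (prodBernoulli (Function.update q f 0)).real E * (1 - (q f : ℝ)) := by
    rw [← hmap, ← hnot, mul_comm, ← hind, inter_comm, ← hEeq]
  have hreal : (prodBernoulli (Function.update q f 0)).real E ≤ (1 - (pc : ℝ))⁻¹ * (prodBernoulli q).real E := by
    rw [hprod]
    set Y : ℝ := (prodBernoulli (Function.update q f 0)).real E with hY
    have hY0 : 0 ≤ Y := measureReal_nonneg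
    have hge : 1 ≤ (1 - (pc : ℝ))⁻¹ * (1 - (q f : ℝ)) := by
      rw [le_inv_mul_iff₀ (by linarith)]; linarith
    calc Y = Y * 1 := (mul_one Y).symm
      _ ≤ Y * ((1 - (pc : ℝ))⁻¹ * (1 - (q f : ℝ))) := mul_le_mul_of_nonneg_left hge hY0
      _ = (1 - (pc : ℝ))⁻¹ * (Y * (1 - (q f : ℝ))) := by ring
  -- back to `ℝ≥0∞`
  have h1 : prodBernoulli (Function.update q f 0) E =
      ENNReal.ofReal ((prodBernoulli (Function.update q f 0)).real E) :=
    (ENNReal.ofReal_toReal (measure_ne_top _ _)).symm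
  have h2 : μH s E = ENNReal.ofReal ((prodBernoulli q).real E) := (ENNReal.ofReal_toReal (measure_ne_top _ _)).symm
  rw [h1, h2, ← ENNReal.ofReal_mul (by rw [inv_nonneg]; linarith)]
  exact ENNReal.ofReal_le_ofReal hreal

/-- Change of variables `t = c · s` on `[0, c]`. -/
theorem lintegral_Icc_comp_div {G : ℝ → ℝ≥0∞} (hG : Measurable G) {c : ℝ} (hc : 0 < c) :
    ∫⁻ t in Icc 0 c, G (t / c) = ENNReal.ofReal c * ∫⁻ s in Icc 0 1, G s := by
  have hF : Measurable fun t : ℝ => (Icc 0 c).indicator (fun t => G (t / c)) t :=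
    (hG.comp (measurable_id.div_const c)).indicator measurableSet_Icc
  rw [← lintegral_indicator measurableSet_Icc, ← lintegral_indicator measurableSet_Icc]
  conv_lhs => rw [← Real.smul_map_volume_mul_left hc.ne']
  rw [lintegral_smul_measure, lintegral_map hF (measurable_const_mul c), abs_of_pos hc]
  congr 1
  refine lintegral_congr fun s => ?_
  by_cases hs : s ∈ Icc (0 : ℝ) 1
  · have hcs : c * s ∈ Icc 0 c := ⟨mul_nonneg hc.le hs.1, by nlinarith [hs.2]⟩
    rw [indicator_of_mem hcs, indicator_of_mem hs, mul_div_cancel_left₀ _ hc.ne']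
  · have hcs : c * s ∉ Icc 0 c := by
      rintro ⟨h1, h2⟩
      apply hs
      constructor
      · nlinarith
      · nlinarith
    rw [indicator_of_notMem hcs, indicator_of_notMem hs]

/-- The floor density belonging to the absolute level `t` (junk outside `[0, p_c]`). -/
def sOf (t : ℝ) : unitInterval := Set.projIcc 0 1 zero_le_one (t / pc)

/-- `coe_sOf_mul` (helper, see the module docstring). -/
theorem coe_sOf_mul {t : ℝ} (ht0 : 0 ≤ t) (ht : t ≤ pc) : (sOf t : ℝ) * pc = t := by
  have h : t / pc ∈ Icc (0 : ℝ) 1 := ⟨div_nonneg ht0 pc_pos.le, (div_le_one pc_pos).2 ht⟩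
  rw [sOf, Set.projIcc_of_mem _ h]
  show t / pc * pc = t
  exact div_mul_cancel₀ t pc_pos.ne'

/-- `measurable_sOf` (helper, see the module docstring). -/
theorem measurable_sOf : Measurable sOf :=
  continuous_projIcc.measurable.comp (measurable_id.div_const _)

/-- The measurable integrand `t ↦ P^{ℍ}_{p_c, s(t)}(E)`. -/
theorem measurable_μH_sOf {E : Set (BondConfig (Site 3))} (hE : MeasurableSet E) :
    Measurable fun t : ℝ => μH (sOf t) E :=
  (measurable_floorDilutedPercolation_apply _ hE).comp measurable_sOf

/-- For `0 ≤ t ≤ p_c`, the labels probability of `{θ^f_t ∈ E}` is the zeroed-weight probability. -/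
theorem ν_θoff_eq (f : E3) {t : ℝ} (ht0 : 0 ≤ t) (ht : t ≤ pc) {E : Set (Set E3)} (hE : MeasurableSet E) :
    ν {U | θoff f t U ∈ E} = prodBernoulli (Function.update (floorDilutedParam 3 pc (sOf t)) f 0) E := by
  classical
  have ht1 : t ≤ 1 := ht.trans pc.2.2
  set tI : unitInterval := ⟨t, ht0, ht1⟩ with htI
  have hlv : lvI Fl base tI = floorDilutedParam 3 pc (sOf t) := by
    rw [← lvI_mul_eq]; congr 1
    exact Subtype.ext (by rw [htI, Set.Icc.coe_mul, coe_sOf_mul ht0 ht])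
  set P : E3 → unitInterval := Function.update (lvI Fl base tI) f 0 with hP
  -- `θoff f t U = lcfg P U` whenever `U f > 0`
  have hcfg : ∀ U : E3 → ℝ, 0 < U f → θoff f t U = lcfg P U := by
    intro U hU
    ext i
    rw [mem_lcfg_iff]
    show i ∈ levelCfgOff Fl base f t U ↔ _
    rw [mem_levelCfgOff_iff]
    by_cases hi : i = f
    · subst hi
      rw [hP, Function.update_self]
      constructor
      · exact fun h => absurd rfl h.1
      · intro h
        have h' : U i ≤ 0 := h
        exact absurd h' (not_le.2 hU)
    · rw [hP, Function.update_of_ne hi, coe_lvI]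
      exact ⟨fun h => h.2, fun h => ⟨hi, h⟩⟩
  have hae : {U : E3 → ℝ | θoff f t U ∈ E} =ᵐ[ν] ((lcfg P) ⁻¹' E : Set (E3 → ℝ)) := by
    filter_upwards [ae_forall_pos (ι := E3)] with U hU
    simp only [eq_iff_iff]
    show θoff f t U ∈ E ↔ lcfg P U ∈ E
    rw [hcfg U (hU f)]
  rw [measure_congr hae, unifLabels_preimage_lcfg P hE, hP, hlv]

/-- **The probability of the oriented pivotal event** is at most the `s`-integral of the
`P^{ℍ}_{p_c,s}`-probability of the pivotal-pair event (constant `p_c/(1-p_c) ≤ 1`). -/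
theorem ν_oPiv_le (a b : Site 3) {x e : Site 3} (hx : x 0 = 0) (he : e ∈ nbrs) :
    ν (OPiv a b x e) ≤ ∫⁻ s : unitInterval, μH s (pivAt x (x + e) a b) := by
  classical
  set f : E3 := s(x, x + e) with hf
  set E : Set (BondConfig (Site 3)) := pivAt x (x + e) a b with hE
  have hEm : MeasurableSet E := measurableSet_pivAt _ _ _ _
  -- measurability of the joint level map and of the event
  have hjoint : Measurable fun p : ℝ × (E3 → ℝ) => θoff f p.1 p.2 := measurable_levelCfgOff_uncurry f
  set S : Set (ℝ × (E3 → ℝ)) := {p | p.1 ≤ (pc : ℝ) ∧ θoff f p.1 p.2 ∈ E} with hS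
  have hSm : MeasurableSet S :=
    (measurableSet_le measurable_fst measurable_const).inter (hjoint hEm)
  have hOm : MeasurableSet (OPiv a b x e) := by
    have : OPiv a b x e = (fun U : E3 → ℝ => (U f, U)) ⁻¹' S := by
      ext U; simp [OPiv, hS, hf, hE]
    rw [this]
    exact ((measurable_pi_apply f).prodMk measurable_id) hSm
  -- resample the `f`-th label
  have hupd : Measurable fun p : ℝ × (E3 → ℝ) => Function.update p.2 f p.1 :=
    measurable_pi_lambda _ fun i => by
      by_cases hi : i = f
      · subst hi; simpa using measurable_fst
      · simp only [Function.update_of_ne hi]; exact (measurable_pi_apply i).comp measurable_snd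
  have hpre : (fun p : ℝ × (E3 → ℝ) => Function.update p.2 f p.1) ⁻¹' OPiv a b x e = S := by
    ext ⟨t, U⟩
    simp only [mem_preimage, hS, mem_setOf_eq]
    show Function.update U f t f ≤ (pc : ℝ) ∧
        levelCfgOff Fl base f (Function.update U f t f) (Function.update U f t) ∈ E ↔
      t ≤ (pc : ℝ) ∧ levelCfgOff Fl base f t U ∈ E
    rw [Function.update_self, levelCfgOff_update]
  have h1 : ν (OPiv a b x e) = (unif.prod ν) S := by
    rw [← hpre, ← Measure.map_apply hupd hOm, map_update_prod_unifLabels]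
  -- Fubini
  have h2 : (unif.prod ν) S = ∫⁻ t, ν (Prod.mk t ⁻¹' S) ∂unif := Measure.prod_apply hSm
  -- the sections
  have hsec : ∀ t : ℝ, ν (Prod.mk t ⁻¹' S) ≤
      (Icc (0 : ℝ) pc).indicator (fun t => ENNReal.ofReal ((1 - (pc : ℝ))⁻¹) * μH (sOf t) E) t +
        ({t : ℝ | t < 0}).indicator (fun _ => 1) t := by
    intro t
    by_cases ht : t ≤ (pc : ℝ)
    · by_cases ht0 : 0 ≤ t
      · have hset : Prod.mk t ⁻¹' S = {U | θoff f t U ∈ E} := by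
          ext U; simp only [hS, mem_preimage, mem_setOf_eq]; exact ⟨fun h => h.2, fun h => ⟨ht, h⟩⟩
        rw [hset, ν_θoff_eq f ht0 ht hEm, indicator_of_mem (show t ∈ Icc (0 : ℝ) pc from ⟨ht0, ht⟩),
          indicator_of_notMem (show t ∉ {t : ℝ | t < 0} from fun h => (not_lt.2 ht0) h), add_zero]
        exact prodBernoulli_update_zero_pivAt_le (sOf t) hx he a b
      · rw [indicator_of_mem (show t ∈ {t : ℝ | t < 0} from not_le.1 ht0)]
        exact le_add_left (prob_le_one)
    · have hset : Prod.mk t ⁻¹' S = ∅ := by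
        ext U
        simp only [hS, mem_preimage, mem_setOf_eq, mem_empty_iff_false, iff_false, not_and]
        exact fun h _ => ht h
      rw [hset, measure_empty]; exact zero_le
  -- integrate the section bound
  have hneg : unif {t : ℝ | t < 0} = 0 := by
    rw [unif, Measure.restrict_apply' measurableSet_Icc]
    have : {t : ℝ | t < 0} ∩ Icc 0 1 = ∅ := by
      ext t; simp only [mem_inter_iff, mem_setOf_eq, mem_Icc, mem_empty_iff_false, iff_false]
      rintro ⟨h1, h2, -⟩; linarith
    rw [this, measure_empty]
  have hmeasG : Measurable fun t : ℝ => ENNReal.ofReal ((1 - (pc : ℝ))⁻¹) * μH (sOf t) E :=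
    measurable_const.mul (measurable_μH_sOf hEm)
  have hm0 : MeasurableSet {t : ℝ | t < 0} := measurableSet_lt measurable_id measurable_const
  have h3 : ∫⁻ t, ν (Prod.mk t ⁻¹' S) ∂unif ≤
      ENNReal.ofReal ((1 - (pc : ℝ))⁻¹) * (ENNReal.ofReal (pc : ℝ) * ∫⁻ s in Icc (0 : ℝ) 1, μH (sOf (s * pc)) E) := by
    calc ∫⁻ t, ν (Prod.mk t ⁻¹' S) ∂unif
        ≤ ∫⁻ t, (Icc (0 : ℝ) pc).indicator (fun t => ENNReal.ofReal ((1 - (pc : ℝ))⁻¹) * μH (sOf t) E) t +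
            ({t : ℝ | t < 0}).indicator (fun _ => 1) t ∂unif := lintegral_mono hsec
      _ = ∫⁻ t, (Icc (0 : ℝ) pc).indicator (fun t => ENNReal.ofReal ((1 - (pc : ℝ))⁻¹) * μH (sOf t) E) t ∂unif +
            ∫⁻ t, ({t : ℝ | t < 0}).indicator (fun _ => (1 : ℝ≥0∞)) t ∂unif := by
          rw [lintegral_add_left (hmeasG.indicator measurableSet_Icc)]
      _ = (∫⁻ t in Icc (0 : ℝ) pc, ENNReal.ofReal ((1 - (pc : ℝ))⁻¹) * μH (sOf t) E ∂unif) +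
            ∫⁻ _t in {t : ℝ | t < 0}, (1 : ℝ≥0∞) ∂unif := by
          rw [lintegral_indicator measurableSet_Icc, lintegral_indicator hm0]
      _ = ∫⁻ t in Icc (0 : ℝ) pc, ENNReal.ofReal ((1 - (pc : ℝ))⁻¹) * μH (sOf t) E ∂unif := by
          rw [setLIntegral_const, hneg, mul_zero, add_zero]
      _ ≤ ∫⁻ t in Icc (0 : ℝ) pc, ENNReal.ofReal ((1 - (pc : ℝ))⁻¹) * μH (sOf t) E := by
          -- `unif ≤ volume`
          exact lintegral_mono' (Measure.restrict_mono subset_rfl (by rw [unif]; exact Measure.restrict_le_self)) le_rfl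
      _ = ENNReal.ofReal ((1 - (pc : ℝ))⁻¹) * ∫⁻ t in Icc (0 : ℝ) pc, μH (sOf t) E := by
          rw [lintegral_const_mul _ (measurable_μH_sOf hEm)]
      _ = ENNReal.ofReal ((1 - (pc : ℝ))⁻¹) * (ENNReal.ofReal (pc : ℝ) * ∫⁻ s in Icc (0 : ℝ) 1, μH (sOf (s * pc)) E) := by
          congr 1
          have := lintegral_Icc_comp_div (G := fun u => μH (sOf (u * pc)) E)
            ((measurable_μH_sOf hEm).comp (measurable_id.mul_const _)) pc_pos
          rw [← this]
          refine setLIntegral_congr_fun measurableSet_Icc fun t _ => ?_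
          rw [div_mul_cancel₀ _ pc_pos.ne']
  -- the constant `p_c / (1 - p_c) ≤ 1`
  have hconst : ENNReal.ofReal ((1 - (pc : ℝ))⁻¹) * ENNReal.ofReal (pc : ℝ) ≤ 1 := by
    rw [← ENNReal.ofReal_mul (by rw [inv_nonneg]; linarith [pc_lt_half]), ← ENNReal.ofReal_one]
    refine ENNReal.ofReal_le_ofReal ?_
    rw [inv_mul_le_iff₀ (by linarith [pc_lt_half])]
    linarith [pc_lt_half]
  -- identify the `[0,1]`-integral with the integral over `unitInterval`
  have h4 : ∫⁻ s in Icc (0 : ℝ) 1, μH (sOf (s * pc)) E = ∫⁻ s : unitInterval, μH s E := by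
    have hmp := unitInterval.measurePreserving_coe
    have key := hmp.setLIntegral_comp_preimage_emb unitInterval.measurableEmbedding_coe
      (fun u : ℝ => μH (sOf (u * pc)) E) univ
    rw [Set.preimage_univ, Measure.restrict_univ, Measure.restrict_univ] at key
    rw [← key]
    refine lintegral_congr fun s => ?_
    have hs : (s : ℝ) * pc ≤ pc := by
      have := mul_le_of_le_one_left pc.2.1 s.2.2; linarith
    have hmul := coe_sOf_mul (mul_nonneg s.2.1 pc.2.1) hs
    have hval : (sOf ((s : ℝ) * pc) : ℝ) = s := mul_right_cancel₀ pc_pos.ne' hmul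
    rw [show sOf ((s : ℝ) * pc) = s from Subtype.ext hval]
  calc ν (OPiv a b x e) = ∫⁻ t, ν (Prod.mk t ⁻¹' S) ∂unif := by rw [h1, h2]
    _ ≤ ENNReal.ofReal ((1 - (pc : ℝ))⁻¹) * (ENNReal.ofReal (pc : ℝ) * ∫⁻ s in Icc (0 : ℝ) 1, μH (sOf (s * pc)) E) := h3
    _ = (ENNReal.ofReal ((1 - (pc : ℝ))⁻¹) * ENNReal.ofReal (pc : ℝ)) * ∫⁻ s : unitInterval, μH s E := by
        rw [mul_assoc, h4]
    _ ≤ 1 * ∫⁻ s : unitInterval, μH s E := by gcongr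
    _ = ∫⁻ s : unitInterval, μH s E := one_mul _

end Fubini

/-! ### Assembly of `stub_floorCoupling` -/

section Assembly

/-- **The integrated Russo inequality in the floor density** (registered stub `stub_floorCoupling`
of the line SketchIdeator1, crux `LowPointBookkeeping`): for `a, b` at height `≥ 1`,
`P_ℍ(a ↔ b) ≤ P_{ℍ₊}(a ↔ b) + Σ_{x ∈ ∂ℍ} Σ_e ∫₀¹ P^{ℍ}_{p_c,s}(x ↔_ℍ a, x+e ↔_ℍ b, x ↮_ℍ x+e) ds`.
Proof: realise all `P^{ℍ}_{p_c,s}` by uniform labels; on `{a ↔_ℍ b} ∖ {a ↔_{ℍ₊} b}` at `s = 1` some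
floor edge is pivotal at the level of its own label (a.s. finiteness of `C_ℍ(a)` by BGN + Harris,
discrete pivot lemma, decomposition of the pivotal edge); resample that label (Fubini) and pay
`p_c/(1 - p_c) ≤ 1` for forcing the edge closed. -/
theorem floorCoupling (a b : Site 3) (ha : 1 ≤ a 0) (hb : 1 ≤ b 0) :
    μH 1 (openConnIn HS a b) ≤ μH 1 (openConnIn HP a b) +
      ∑' x : {x : Site 3 // x 0 = 0}, ∑ e ∈ nbrs, ∫⁻ s : unitInterval, μH s (pivAt (x : Site 3) ((x : Site 3) + e) a b) := by
  classical
  have hAm : MeasurableSet (openConnIn HS a b : Set (Set E3)) := measurableSet_openConnIn_of_countable _ _ _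
  have hA'm : MeasurableSet (openConnIn HP a b : Set (Set E3)) := measurableSet_openConnIn_of_countable _ _ _
  -- pass to the labels
  rw [← ν_preimage_θ_one hAm, ← ν_preimage_θ_one hA'm]
  set D : Set (E3 → ℝ) := (θ (pc : ℝ)) ⁻¹' openConnIn HS a b \ (θ (pc : ℝ)) ⁻¹' openConnIn HP a b with hD
  have hsplit : ν ((θ (pc : ℝ)) ⁻¹' openConnIn HS a b) ≤ ν ((θ (pc : ℝ)) ⁻¹' openConnIn HP a b) + ν D := by
    calc ν ((θ (pc : ℝ)) ⁻¹' openConnIn HS a b)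
        ≤ ν ((θ (pc : ℝ)) ⁻¹' openConnIn HP a b ∪ D) := measure_mono fun U hU => by
          by_cases h : U ∈ (θ (pc : ℝ)) ⁻¹' openConnIn HP a b
          · exact Or.inl h
          · exact Or.inr ⟨hU, h⟩
      _ ≤ _ := measure_union_le _ _
  refine hsplit.trans (add_le_add le_rfl ?_)
  -- the good labels
  set Good : Set (E3 → ℝ) := {U | (∀ i, 0 < U i) ∧ Set.InjOn U Fl ∧ (clusterIn HS (θ (pc : ℝ) U) a).Finite} with hGood
  have hGood : ∀ᵐ U ∂ν, U ∈ Good := by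
    have hfin : ∀ᵐ U ∂ν, (clusterIn HS (θ (pc : ℝ) U) a).Finite := by
      have h0 : ν ((θ (pc : ℝ)) ⁻¹' InfCl a) = 0 := by
        rw [ν_preimage_θ_one (measurableSet_infCl a)]; exact measure_infCl a (by omega)
      have := measure_eq_zero_iff_ae_notMem.1 h0
      filter_upwards [this] with U hU using Set.not_infinite.1 hU
    filter_upwards [ae_forall_pos (ι := E3), ae_injOn (ι := E3) Fl, hfin] with U h1 h2 h3 using ⟨h1, h2, h3⟩
  have hGc : ν Goodᶜ = 0 := by
    have := ae_iff.1 hGood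
    simpa only [Set.compl_def] using this
  -- `D ∩ Good` is covered by the oriented pivotal events
  have hcover : D ∩ Good ⊆ ⋃ x : {x : Site 3 // x 0 = 0}, ⋃ e ∈ nbrs, OPiv a b (x : Site 3) e := by
    rintro U ⟨⟨hUA, hUA'⟩, hpos, hinj, hfin⟩
    obtain ⟨x, e, hx, he, hU⟩ := exists_oPiv ha hb hpos hinj hfin hUA hUA'
    exact mem_iUnion.2 ⟨⟨x, hx⟩, mem_iUnion₂.2 ⟨e, he, hU⟩⟩
  calc ν D ≤ ν (D ∩ Good ∪ Goodᶜ) := measure_mono fun U hU => by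
          by_cases h : U ∈ Good
          · exact Or.inl ⟨hU, h⟩
          · exact Or.inr h
    _ ≤ ν (D ∩ Good) + ν Goodᶜ := measure_union_le _ _
    _ = ν (D ∩ Good) := by rw [hGc, add_zero]
    _ ≤ ν (⋃ x : {x : Site 3 // x 0 = 0}, ⋃ e ∈ nbrs, OPiv a b (x : Site 3) e) := measure_mono hcover
    _ ≤ ∑' x : {x : Site 3 // x 0 = 0}, ν (⋃ e ∈ nbrs, OPiv a b (x : Site 3) e) := measure_iUnion_le _
    _ ≤ ∑' x : {x : Site 3 // x 0 = 0}, ∑ e ∈ nbrs, ν (OPiv a b (x : Site 3) e) :=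
        ENNReal.tsum_le_tsum fun x => measure_biUnion_finset_le _ _
    _ ≤ ∑' x : {x : Site 3 // x 0 = 0}, ∑ e ∈ nbrs, ∫⁻ s : unitInterval, μH s (pivAt (x : Site 3) ((x : Site 3) + e) a b) :=
        ENNReal.tsum_le_tsum fun x => Finset.sum_le_sum fun e he => ν_oPiv_le a b x.2 he

end Assembly

end Summit.CriticalPhenomena.PercolationContinuityZ3.Theorems.FloorRusso.Coupling

namespace Summit.CriticalPhenomena.PercolationContinuityZ3.Theorems.FloorRusso

open MeasureTheory
open Literature.Probability.Percolation Literature.Probability.LatticeModels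
open scoped ENNReal

/-- **`stub_floorCoupling`** (registered stub of crux stmt-CriticalPhenomena-14713, line
SketchIdeator1 / skeleton floor-russo): the integrated Russo inequality in the floor-edge density,
`P_ℍ(a ↔ b) ≤ P_{ℍ₊}(a ↔ b) + Σ_{x ∈ ∂ℍ} Σ_{e} ∫₀¹ P^{ℍ}_{p_c,s}(x ↔_ℍ a, x + e ↔_ℍ b, x ↮_ℍ x + e) ds`
for `a, b` at height `≥ 1` (`Coupling.floorCoupling`). -/
theorem stub_floorCoupling :
    ∀ a b : Site 3, 1 ≤ a 0 → 1 ≤ b 0 →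
      floorDilutedPercolation 3 (criticalProbI 3) 1 (openConnIn {x : Site 3 | 0 ≤ x 0} a b) ≤
        floorDilutedPercolation 3 (criticalProbI 3) 1 (openConnIn {x : Site 3 | 1 ≤ x 0} a b) +
          ∑' x : {x : Site 3 // x 0 = 0}, ∑ e ∈ ({Pi.single 1 1, Pi.single 1 (-1), Pi.single 2 1, Pi.single 2 (-1)} : Finset (Site 3)),
            ∫⁻ s : unitInterval,
              floorDilutedPercolation 3 (criticalProbI 3) s
                (openConnIn {x : Site 3 | 0 ≤ x 0} (x : Site 3) a ∩ openConnIn {x : Site 3 | 0 ≤ x 0} ((x : Site 3) + e) b ∩ (openConnIn {x : Site 3 | 0 ≤ x 0} (x : Site 3) ((x : Site 3) + e))ᶜ) :=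
  fun a b ha hb => Coupling.floorCoupling a b ha hb

end Summit.CriticalPhenomena.PercolationContinuityZ3.Theorems.FloorRusso

end
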